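import Literature.NumberTheory.Sieve.IwaniecBilinearSieveComposite
import Literature.NumberTheory.Sieve.RosserSieveMainTerm
import HarnessLib

/-!
# Iwaniec's bilinear linear sieve, III: the boxes, the box-truncated weights, and Lemma 1

Topic `Literature/NumberTheory/Sieve`; third support file for the proof of
`Literature.NumberTheory.Sieve.Iwaniec1978.lemma2_bilinearSieve` (H. Iwaniec, *A new form of the error
term in the linear sieve*, Acta Arith. 37 (1980), 307–320, Theorem 1 [IwaniecActaArith1980b]), §2 and §4
of the paper:

* the geometric grid `𝒢 = {D^{ε²(1+η)^j} : j ≥ 0}` (p. 311; `Iwaniec1980b.grid`), the box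
  `[D_j, D_j^{1+η})` of a prime `p ≥ u = D^{ε²}` (`boxIdx`, with upper endpoint `dhat p = D_{j+1}`,
  `p < dhat p ≤ p^{1+η}`), and the PATTERN of a squarefree number (`pat t`, the multiset of the boxes of
  its prime factors);
* the box-truncated Rosser conditions: with `D̂` in place of the primes, the condition at a top segment
  `t' = p₁ ⋯ p_m` of `t` reads `D̂(p₁) ⋯ D̂(p_m) · D̂(p_m)² < D` (`condK` on patterns), a function of the
  pattern alone; `AdmC par k` is the resulting admissibility of a pattern `k` (Iwaniec's `𝒟⁺`, `𝒟⁻`,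
  p. 311, in multiset form), and `BetaSieve.predC par (condK ∘ pat) t ↔ AdmC par (pat t)`
  (`predC_condK_iff_admC`): the box weights `μ(t) χ̃^±(t)` of the combinatorial sieve
  (`IwaniecBilinearSieveComposite.lean`) depend on `t` only through its pattern.  Since `p < D̂(p)`, the
  box conditions imply Rosser's (`β = 2`, level `D`), so the box sets sit inside Rosser's and have level
  `D` (`lt_of_predC_condK`);
* **Lemma 1** (p. 312): every admissible pattern splits as `k = k_M + k_N` with
  `∏_{j ∈ k_M} D_j ≤ M'`, `∏_{j ∈ k_N} D_j ≤ N'` whenever `M', N' ≥ 1`, `M'N' = D` (`splitK`,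
  `splitK_spec`; greedy along the recursion, using `D₁ ⋯ D_{r−1} D_r² ≤ D`, `hypL1_of_admC`).

Everything is PROVED; no facts.

## References

* H. Iwaniec, *A new form of the error term in the linear sieve*, Acta Arith. 37 (1980), 307–320: the sets
  `𝒢, ℋ, 𝒟^±` p. 311, Lemma 1 p. 312, §4 pp. 314–315. [IwaniecActaArith1980b]
-/

open Finset Real

noncomputable section

namespace Literature.NumberTheory.Sieve

namespace Iwaniec1980b

variable (D ε η : ℝ)

/-! ### The grid `D_j = D^{ε²(1+η)^j}` and the boxes -/

/-- The grid point `D_j = D^{ε²(1+η)^j}` (`𝒢` of p. 311; `D₀ = u = D^{ε²}`).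
[cite: IwaniecActaArith1980b, p. 311] -/
def grid (j : ℕ) : ℝ := D ^ (ε ^ 2 * (1 + η) ^ j)

variable {D ε η}

/-- `D_{j+1} = D_j^{1+η}`. [folklore] -/
theorem grid_succ (hD : 0 ≤ D) (j : ℕ) : grid D ε η (j + 1) = grid D ε η j ^ (1 + η) := by
  rw [grid, grid, ← Real.rpow_mul hD]
  congr 1
  ring

/-- `1 < D_j` for `D > 1`, `ε ≠ 0`, `η > −1`. [folklore] -/
theorem one_lt_grid (hD : 1 < D) (hε : 0 < ε) (hη : 0 < 1 + η) (j : ℕ) : 1 < grid D ε η j :=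
  Real.one_lt_rpow hD (by positivity)

/-- `0 < D_j`. [folklore] -/
theorem grid_pos (hD : 0 < D) (j : ℕ) : 0 < grid D ε η j := Real.rpow_pos_of_pos hD _

/-- The grid is non-decreasing (`η ≥ 0`, `D ≥ 1`). [folklore] -/
theorem grid_mono (hD : 1 ≤ D) (hη : 0 ≤ η) {i j : ℕ} (hij : i ≤ j) : grid D ε η i ≤ grid D ε η j := by
  unfold grid
  refine Real.rpow_le_rpow_of_exponent_le hD ?_
  exact mul_le_mul_of_nonneg_left (pow_le_pow_right₀ (by linarith) hij) (sq_nonneg ε)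

/-- Every real is eventually below the grid (`D > 1`, `ε > 0`, `η > 0`). [folklore] -/
theorem exists_lt_grid (hD : 1 < D) (hε : 0 < ε) (hη : 0 < η) (x : ℝ) : ∃ j : ℕ, x < grid D ε η j := by
  have hlogD : 0 < Real.log D := Real.log_pos hD
  obtain ⟨n, hn⟩ := pow_unbounded_of_one_lt (Real.log (max x 1) / (ε ^ 2 * Real.log D)) (by linarith : (1 : ℝ) < 1 + η)
  refine ⟨n, ?_⟩
  have hx1 : x ≤ max x 1 := le_max_left _ _
  have hm0 : 0 < max x 1 := lt_of_lt_of_le zero_lt_one (le_max_right _ _)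
  refine lt_of_le_of_lt hx1 ?_
  rw [grid, ← Real.exp_log hm0, Real.rpow_def_of_pos (by linarith), Real.exp_lt_exp]
  rw [div_lt_iff₀ (by positivity)] at hn
  nlinarith

/-- Every prime (indeed every natural number) lies below some `D_{j+1}`. [folklore] -/
theorem exists_lt_grid_succ (hD : 1 < D) (hε : 0 < ε) (hη : 0 < η) (p : ℕ) :
    ∃ j : ℕ, (p : ℝ) < grid D ε η (j + 1) :=
  (exists_lt_grid hD hε hη (p : ℝ)).imp fun j hj => hj.trans_le (grid_mono hD.le hη.le (Nat.le_succ j))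

open Classical in
/-- The box index of `p`: the least `j` with `p < D_{j+1}`; for `p ≥ u` this is the `j` with
`D_j ≤ p < D_{j+1}`. [cite: IwaniecActaArith1980b, §4 p. 315] -/
def boxIdx (hD : 1 < D) (hε : 0 < ε) (hη : 0 < η) (p : ℕ) : ℕ := Nat.find (exists_lt_grid_succ hD hε hη p)

section Box

variable (hD : 1 < D) (hε : 0 < ε) (hη : 0 < η)
include hD hε hη

/-- `p < D_{boxIdx p + 1}`. [folklore] -/
theorem lt_grid_boxIdx_succ (p : ℕ) : (p : ℝ) < grid D ε η (boxIdx hD hε hη p + 1) := by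
  unfold boxIdx
  exact Nat.find_spec (exists_lt_grid_succ hD hε hη p)

/-- Minimality: if `p < D_{j+1}` then `boxIdx p ≤ j`. [folklore] -/
theorem boxIdx_le_of_lt {p : ℕ} {j : ℕ} (h : (p : ℝ) < grid D ε η (j + 1)) : boxIdx hD hε hη p ≤ j := by
  unfold boxIdx
  exact Nat.find_min' _ h

/-- Below the box index the grid has been passed: `D_{m+1} ≤ p` for `m < boxIdx p`. [folklore] -/
theorem grid_succ_le_of_lt_boxIdx {p m : ℕ} (hm : m < boxIdx hD hε hη p) : grid D ε η (m + 1) ≤ (p : ℝ) := by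
  unfold boxIdx at hm
  exact not_lt.mp (Nat.find_min _ hm)

/-- For `p ≥ u = D₀`, `D_{boxIdx p} ≤ p`. [folklore] -/
theorem grid_boxIdx_le {p : ℕ} (hp : grid D ε η 0 ≤ (p : ℝ)) : grid D ε η (boxIdx hD hε hη p) ≤ (p : ℝ) := by
  rcases Nat.eq_zero_or_pos (boxIdx hD hε hη p) with h0 | hpos
  · rw [h0]; exact hp
  · have h := grid_succ_le_of_lt_boxIdx hD hε hη (p := p) (m := boxIdx hD hε hη p - 1) (by omega)
    rwa [Nat.sub_add_cancel hpos] at h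

/-- `boxIdx` is monotone. [folklore] -/
theorem boxIdx_mono {p q : ℕ} (hpq : p ≤ q) : boxIdx hD hε hη p ≤ boxIdx hD hε hη q :=
  boxIdx_le_of_lt hD hε hη ((Nat.cast_le.mpr hpq).trans_lt (lt_grid_boxIdx_succ hD hε hη q))

/-- The upper endpoint `D̂(p) = D_{boxIdx p + 1}` of the box of `p`. [cite: IwaniecActaArith1980b, §4 p. 315] -/
def dhat (p : ℕ) : ℝ := grid D ε η (boxIdx hD hε hη p + 1)

/-- `p < D̂(p)`. [folklore] -/
theorem lt_dhat (p : ℕ) : (p : ℝ) < dhat hD hε hη p := lt_grid_boxIdx_succ hD hε hη p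

/-- `D̂(p) ≤ p^{1+η}` for `p ≥ u`. [folklore] -/
theorem dhat_le_rpow {p : ℕ} (hp : grid D ε η 0 ≤ (p : ℝ)) : dhat hD hε hη p ≤ (p : ℝ) ^ (1 + η) := by
  rw [dhat, grid_succ (by linarith)]
  exact Real.rpow_le_rpow (grid_pos (by linarith) _).le (grid_boxIdx_le hD hε hη hp) (by linarith)

/-- `1 < D̂(p)`. [folklore] -/
theorem one_lt_dhat (p : ℕ) : 1 < dhat hD hε hη p := one_lt_grid hD hε (by linarith) _

end Box

/-! ### Patterns and the box-truncated conditions -/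

/-- The least element of a multiset of naturals (`0` for the empty multiset). [folklore] -/
def mmin (k : Multiset ℕ) : ℕ := if h : k.toFinset.Nonempty then k.toFinset.min' h else 0

/-- `mmin k ∈ k` for `k ≠ 0`. [folklore] -/
theorem mmin_mem {k : Multiset ℕ} (hk : k ≠ 0) : mmin k ∈ k := by
  have h : k.toFinset.Nonempty := by
    rw [Finset.nonempty_iff_ne_empty, Ne, Multiset.toFinset_eq_empty]; exact hk
  rw [mmin, dif_pos h, ← Multiset.mem_toFinset]
  exact Finset.min'_mem _ _

/-- `mmin k ≤ j` for every `j ∈ k`. [folklore] -/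
theorem mmin_le {k : Multiset ℕ} {j : ℕ} (hj : j ∈ k) : mmin k ≤ j := by
  have h : k.toFinset.Nonempty := ⟨j, Multiset.mem_toFinset.mpr hj⟩
  rw [mmin, dif_pos h]
  exact Finset.min'_le _ _ (Multiset.mem_toFinset.mpr hj)

/-- Characterisation of `mmin` on a nonempty multiset. [folklore] -/
theorem mmin_eq_of_mem_of_le {k : Multiset ℕ} {m : ℕ} (hm : m ∈ k) (hle : ∀ j ∈ k, m ≤ j) :
    mmin k = m :=
  le_antisymm (mmin_le hm) (hle _ (mmin_mem (by rintro rfl; simp at hm)))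

section Pattern

variable (hD : 1 < D) (hε : 0 < ε) (hη : 0 < η)
include hD hε hη

/-- The pattern of `t`: the multiset of the boxes of its prime factors ("`d` belongs to the sequence
`(D₁, …, D_r)`", p. 315). [cite: IwaniecActaArith1980b, §4 p. 315] -/
def pat (t : ℕ) : Multiset ℕ := t.primeFactors.val.map (boxIdx hD hε hη)

/-- `card (pat t) = ν(t)`. [folklore] -/
theorem card_pat (t : ℕ) : Multiset.card (pat hD hε hη t) = t.primeFactors.card := by
  rw [pat, Multiset.card_map]; rfl

/-- `pat 1 = 0`. [folklore] -/
theorem pat_one : pat hD hε hη 1 = 0 := by simp [pat]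

/-- Membership in the pattern. [folklore] -/
theorem mem_pat_iff {t : ℕ} {j : ℕ} : j ∈ pat hD hε hη t ↔ ∃ p ∈ t.primeFactors, boxIdx hD hε hη p = j := by
  rw [pat, Multiset.mem_map]; rfl

/-- The least box of `t ≠ 1` is the box of its least prime factor. [folklore] -/
theorem mmin_pat {t : ℕ} (ht : t ≠ 1) (ht0 : t ≠ 0) : mmin (pat hD hε hη t) = boxIdx hD hε hη t.minFac := by
  refine mmin_eq_of_mem_of_le ?_ ?_
  · exact (mem_pat_iff hD hε hη).mpr ⟨t.minFac, Nat.mem_primeFactors.mpr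
      ⟨Nat.minFac_prime ht, Nat.minFac_dvd t, ht0⟩, rfl⟩
  · intro j hj
    obtain ⟨p, hp, rfl⟩ := (mem_pat_iff hD hε hη).mp hj
    exact boxIdx_mono hD hε hη (Nat.minFac_le_of_dvd (Nat.prime_of_mem_primeFactors hp).two_le
      (Nat.dvd_of_mem_primeFactors hp))

/-- Removing the least prime factor removes the least box: `pat (t / q(t)) = (pat t).erase (mmin (pat t))`
for squarefree `t ≠ 1`. [folklore] -/
theorem pat_div_minFac {t : ℕ} (ht : Squarefree t) (h1 : t ≠ 1) :
    pat hD hε hη (t / t.minFac) = (pat hD hε hη t).erase (mmin (pat hD hε hη t)) := by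
  have ht0 : t ≠ 0 := ht.ne_zero
  have hp := Nat.minFac_prime h1
  set t' := t / t.minFac with ht'
  have ht'0 : t' ≠ 0 := (Nat.div_pos (Nat.minFac_le (Nat.pos_of_ne_zero ht0)) hp.pos).ne'
  have hnd : ¬ t.minFac ∣ t' := BetaSieve.not_minFac_dvd_div ht h1
  have hpf : t.primeFactors = insert t.minFac t'.primeFactors := by
    conv_lhs => rw [← BetaSieve.div_minFac_mul (A := t)]
    rw [BetaSieve.primeFactors_mul_prime hp ht'0, Finset.union_comm]; rfl
  have hnotin : t.minFac ∉ t'.primeFactors := fun h => hnd (Nat.dvd_of_mem_primeFactors h)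
  rw [mmin_pat hD hε hη h1 ht0, pat, pat, hpf, Finset.insert_val_of_notMem hnotin, Multiset.map_cons,
    Multiset.erase_cons_head]

/-- The product of the upper endpoints over a pattern: `∏_{j ∈ k} D_{j+1}` (`= ∏_{p ∣ t} D̂(p)` for
`k = pat t`). [cite: IwaniecActaArith1980b, §4 p. 315] -/
def bprod (k : Multiset ℕ) : ℝ := (k.map fun j => grid D ε η (j + 1)).prod

omit hD hε hη in
/-- `bprod 0 = 1`. [folklore] -/
theorem bprod_zero : bprod (D := D) (ε := ε) (η := η) 0 = 1 := by simp [bprod]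

omit hD hε hη in
/-- `bprod (j ::ₘ k) = D_{j+1} · bprod k`. [folklore] -/
theorem bprod_cons (j : ℕ) (k : Multiset ℕ) :
    bprod (D := D) (ε := ε) (η := η) (j ::ₘ k) = grid D ε η (j + 1) * bprod (D := D) (ε := ε) (η := η) k := by
  simp [bprod]

/-- `∏_{p ∣ t} D̂(p) = bprod (pat t)`. [folklore] -/
theorem prod_dhat_eq_bprod (t : ℕ) :
    ∏ p ∈ t.primeFactors, dhat hD hε hη p = bprod (D := D) (ε := ε) (η := η) (pat hD hε hη t) := by
  rw [bprod, pat, Multiset.map_map, Finset.prod_eq_multiset_prod]; rfl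

/-- `t ≤ bprod (pat t)` for squarefree `t` (each prime is below the upper endpoint of its box). [folklore] -/
theorem le_bprod_pat {t : ℕ} (ht : Squarefree t) : (t : ℝ) ≤ bprod (D := D) (ε := ε) (η := η) (pat hD hε hη t) := by
  rw [← prod_dhat_eq_bprod hD hε hη]
  conv_lhs => rw [← Nat.prod_primeFactors_of_squarefree ht]
  push_cast
  exact Finset.prod_le_prod (fun p _ => (Nat.cast_nonneg p)) fun p _ => (lt_dhat hD hε hη p).le

/-- **The box-truncated Rosser condition on a pattern** (`β = 2`): at a top segment with pattern `k` and
least box `j₀ = mmin k`, `(∏_{j ∈ k} D_{j+1}) · D_{j₀+1}² < D`, i.e. `D̂(p₁) ⋯ D̂(p_m) D̂(p_m)² < D` — the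
conditions `D₁ ⋯ D_{2l} D³_{2l+1} < D` of `𝒟^±` (p. 311) written with upper endpoints.
[cite: IwaniecActaArith1980b, p. 311 (𝒟⁺, 𝒟⁻)] -/
def condK (k : Multiset ℕ) : Prop :=
  bprod (D := D) (ε := ε) (η := η) k * grid D ε η (mmin k + 1) ^ 2 < D

/-- **Admissibility of a pattern** (`𝒟⁺` for `par = 1`, `𝒟⁻` for `par = 0`, in multiset form): remove the
least box repeatedly; the condition `condK` is imposed whenever the current cardinality is `≡ par (mod 2)`.
[cite: IwaniecActaArith1980b, p. 311 (𝒟⁺, 𝒟⁻)] -/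
def AdmC (par : ℕ) : Multiset ℕ → Prop
  | k =>
    if _ : k = 0 then True
    else AdmC par (k.erase (mmin k)) ∧ (Multiset.card k % 2 = par % 2 → condK (D := D) (ε := ε) (η := η) k)
termination_by k => Multiset.card k
decreasing_by
  rw [Multiset.card_erase_of_mem (mmin_mem ‹_›)]
  exact Nat.pred_lt (by rw [Ne, Multiset.card_eq_zero]; exact ‹_›)

omit hD hε hη in
/-- `AdmC par 0`. [folklore] -/
theorem admC_zero (par : ℕ) : AdmC (D := D) (ε := ε) (η := η) par 0 := by
  rw [AdmC, dif_pos rfl]; trivial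

omit hD hε hη in
/-- Unfolding `AdmC` at `k ≠ 0`. [folklore] -/
theorem admC_iff {par : ℕ} {k : Multiset ℕ} (hk : k ≠ 0) :
    AdmC (D := D) (ε := ε) (η := η) par k ↔
      AdmC (D := D) (ε := ε) (η := η) par (k.erase (mmin k)) ∧
        (Multiset.card k % 2 = par % 2 → condK (D := D) (ε := ε) (η := η) k) := by
  rw [AdmC, dif_neg hk]

/-- **The box weights depend only on the pattern**: for squarefree `t`,
`predC par (condK ∘ pat) t ↔ AdmC par (pat t)`. [cite: IwaniecActaArith1980b, §4 p. 315] -/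
theorem predC_condK_iff_admC (par : ℕ) :
    ∀ {t : ℕ}, Squarefree t →
      (BetaSieve.predC par (fun t => condK (D := D) (ε := ε) (η := η) (pat hD hε hη t)) t ↔
        AdmC (D := D) (ε := ε) (η := η) par (pat hD hε hη t)) := by
  intro t
  induction t using Nat.strong_induction_on with
  | _ t ih =>
    intro ht
    by_cases h1 : t ≤ 1
    · have : t = 1 := by
        have := ht.ne_zero; omega
      subst this
      rw [pat_one]
      exact ⟨fun _ => admC_zero par, fun _ => BetaSieve.predC_one⟩
    have h1' : 1 < t := not_le.mp h1
    have ht1 : t ≠ 1 := by omega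
    have ht0 : t ≠ 0 := ht.ne_zero
    have hlt : t / t.minFac < t := Nat.div_lt_self (by omega) (Nat.minFac_prime ht1).one_lt
    have ht' : Squarefree (t / t.minFac) := ht.squarefree_of_dvd (Nat.div_dvd_of_dvd (Nat.minFac_dvd t))
    have hk0 : pat hD hε hη t ≠ 0 := by
      rw [Ne, ← Multiset.card_eq_zero, card_pat, Finset.card_eq_zero, Nat.primeFactors_eq_empty]
      omega
    rw [BetaSieve.predC_iff h1', admC_iff hk0, ← pat_div_minFac hD hε hη ht ht1, ih _ hlt ht',
      card_pat]

/-- The box condition implies Rosser's condition with `β = 2`: `condK (pat t) → t · q(t)² < D`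
(squarefree `t ≠ 1`). [folklore] -/
theorem rosser_of_condK {t : ℕ} (ht : Squarefree t) (h1 : t ≠ 1)
    (h : condK (D := D) (ε := ε) (η := η) (pat hD hε hη t)) : (t : ℝ) * (t.minFac : ℝ) ^ (2 : ℝ) < D := by
  have ht0 := ht.ne_zero
  unfold condK at h
  rw [mmin_pat hD hε hη h1 ht0] at h
  have h1' : (t : ℝ) ≤ bprod (D := D) (ε := ε) (η := η) (pat hD hε hη t) := le_bprod_pat hD hε hη ht
  have h2 : (t.minFac : ℝ) ^ (2 : ℝ) ≤ grid D ε η (boxIdx hD hε hη t.minFac + 1) ^ 2 := by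
    rw [Real.rpow_two]
    exact pow_le_pow_left₀ (Nat.cast_nonneg _) (lt_dhat hD hε hη _).le 2
  have h3 : 0 ≤ grid D ε η (boxIdx hD hε hη t.minFac + 1) ^ 2 := sq_nonneg _
  calc (t : ℝ) * (t.minFac : ℝ) ^ (2 : ℝ)
      ≤ bprod (D := D) (ε := ε) (η := η) (pat hD hε hη t) * grid D ε η (boxIdx hD hε hη t.minFac + 1) ^ 2 :=
        mul_le_mul h1' h2 (by positivity) (le_trans (Nat.cast_nonneg _) h1')
    _ < D := h

/-- **The box sets sit inside Rosser's**: `predC par (condK ∘ pat) t → pred par 2 D t` (squarefree `t`).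
[folklore] -/
theorem pred_of_predC_condK (par : ℕ) {t : ℕ} (ht : Squarefree t)
    (h : BetaSieve.predC par (fun t => condK (D := D) (ε := ε) (η := η) (pat hD hε hη t)) t) :
    BetaSieve.pred par 2 D t := by
  -- go through `predC` with Rosser's condition, restricted to squarefree arguments via an auxiliary condition
  have key : ∀ {t : ℕ}, Squarefree t →
      BetaSieve.predC par (fun t => condK (D := D) (ε := ε) (η := η) (pat hD hε hη t)) t →
        BetaSieve.pred par 2 D t := by
    intro t
    induction t using Nat.strong_induction_on with
    | _ t ih =>
      intro ht h
      by_cases h1 : t ≤ 1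
      · exact BetaSieve.pred_of_le_one h1
      have h1' : 1 < t := not_le.mp h1
      have ht1 : t ≠ 1 := by omega
      have hlt : t / t.minFac < t := Nat.div_lt_self (by omega) (Nat.minFac_prime ht1).one_lt
      have ht' : Squarefree (t / t.minFac) := ht.squarefree_of_dvd (Nat.div_dvd_of_dvd (Nat.minFac_dvd t))
      rw [BetaSieve.predC_iff h1'] at h
      rw [BetaSieve.pred_iff h1']
      exact ⟨ih _ hlt ht' h.1, fun hpar => rosser_of_condK hD hε hη ht ht1 (h.2 hpar)⟩
  exact key ht h

/-- **Level of the box weights**: a squarefree `t` in the box set with all prime factors `< z ≤ D` has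
`t < D`. [cite: IwaniecActaArith1980b, §2 p. 312] -/
theorem lt_of_predC_condK (par : ℕ) {t : ℕ} (ht : Squarefree t) {z : ℝ} (hzD : z ≤ D)
    (hpz : ∀ p ∈ t.primeFactors, (p : ℝ) < z)
    (h : BetaSieve.predC par (fun t => condK (D := D) (ε := ε) (η := η) (pat hD hε hη t)) t) :
    (t : ℝ) < D :=
  BetaSieve.lt_level_of_pred_of_one_le (by norm_num) hD hzD ht hpz (pred_of_predC_condK hD hε hη par ht h)

/-- Strict form: `t < bprod (pat t)` for squarefree `t ≠ 1`. [folklore] -/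
theorem lt_bprod_pat {t : ℕ} (ht : Squarefree t) (h1 : t ≠ 1) :
    (t : ℝ) < bprod (D := D) (ε := ε) (η := η) (pat hD hε hη t) := by
  rw [← prod_dhat_eq_bprod hD hε hη]
  conv_lhs => rw [← Nat.prod_primeFactors_of_squarefree ht]
  push_cast
  have hne : t.primeFactors.Nonempty := by
    rw [Finset.nonempty_iff_ne_empty, Ne, Nat.primeFactors_eq_empty]; 
    have := ht.ne_zero; omega
  exact Finset.prod_lt_prod_of_nonempty (fun p hp => by exact_mod_cast (Nat.prime_of_mem_primeFactors hp).pos)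
    (fun p _ => lt_dhat hD hε hη p) hne

end Pattern

/-! ### Products of lower endpoints and Lemma 1 -/

section LemmaOne

/-- The product of the lower endpoints over a pattern: `∏_{j ∈ k} D_j` (`M₁ ⋯ M_s` of Lemma 1).
[cite: IwaniecActaArith1980b, Lemma 1 p. 312] -/
def lprod (k : Multiset ℕ) : ℝ := (k.map (grid D ε η)).prod

/-- `lprod 0 = 1`. [folklore] -/
theorem lprod_zero : lprod (D := D) (ε := ε) (η := η) 0 = 1 := by simp [lprod]

/-- `lprod (j ::ₘ k) = D_j · lprod k`. [folklore] -/
theorem lprod_cons (j : ℕ) (k : Multiset ℕ) :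
    lprod (D := D) (ε := ε) (η := η) (j ::ₘ k) = grid D ε η j * lprod (D := D) (ε := ε) (η := η) k := by
  simp [lprod]

/-- `lprod (a + b) = lprod a · lprod b`. [folklore] -/
theorem lprod_add (a b : Multiset ℕ) :
    lprod (D := D) (ε := ε) (η := η) (a + b) =
      lprod (D := D) (ε := ε) (η := η) a * lprod (D := D) (ε := ε) (η := η) b := by
  simp [lprod, Multiset.map_add, Multiset.prod_add]

/-- `0 < lprod k` (`D > 0`). [folklore] -/
theorem lprod_pos (hD : 0 < D) (k : Multiset ℕ) : 0 < lprod (D := D) (ε := ε) (η := η) k := by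
  rw [lprod]
  refine Multiset.prod_pos fun x hx => ?_
  obtain ⟨j, -, rfl⟩ := Multiset.mem_map.mp hx
  exact grid_pos hD j

/-- `1 ≤ lprod k` (`D ≥ 1`, so every `D_j ≥ 1`). [folklore] -/
theorem one_le_lprod (hD : 1 ≤ D) (hη : 0 ≤ η) (k : Multiset ℕ) : 1 ≤ lprod (D := D) (ε := ε) (η := η) k := by
  induction k using Multiset.induction_on with
  | empty => rw [lprod_zero]
  | cons j k ih =>
    rw [lprod_cons]
    exact one_le_mul_of_one_le_of_one_le
      (Real.one_le_rpow hD (mul_nonneg (sq_nonneg ε) (pow_nonneg (by linarith) j))) ih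

/-- `mmin {j} = j`. [folklore] -/
theorem mmin_singleton (j : ℕ) : mmin {j} = j :=
  mmin_eq_of_mem_of_le (Multiset.mem_singleton_self j) fun _ hi => (Multiset.mem_singleton.mp hi).ge

/-- `lprod (k.erase j) · D_j = lprod k` for `j ∈ k`. [folklore] -/
theorem lprod_erase_mul {k : Multiset ℕ} {j : ℕ} (hj : j ∈ k) :
    lprod (D := D) (ε := ε) (η := η) (k.erase j) * grid D ε η j = lprod (D := D) (ε := ε) (η := η) k := by
  conv_rhs => rw [← Multiset.cons_erase hj, lprod_cons]
  ring

/-- `bprod k = (lprod k)^{1+η}` (`D_{j+1} = D_j^{1+η}` termwise). [folklore] -/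
theorem bprod_eq_lprod_rpow (hD : 0 ≤ D) (k : Multiset ℕ) :
    bprod (D := D) (ε := ε) (η := η) k = lprod (D := D) (ε := ε) (η := η) k ^ (1 + η) := by
  induction k using Multiset.induction_on with
  | empty => rw [bprod_zero, lprod_zero, Real.one_rpow]
  | cons j k ih =>
    have h1 : 0 ≤ grid D ε η j := Real.rpow_nonneg hD _
    have h2 : 0 ≤ lprod (D := D) (ε := ε) (η := η) k := by
      rw [lprod]
      refine Multiset.prod_nonneg fun x hx => ?_
      obtain ⟨_, -, rfl⟩ := Multiset.mem_map.mp hx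
      exact Real.rpow_nonneg hD _
    rw [bprod_cons, lprod_cons, ih, grid_succ hD, Real.mul_rpow h1 h2]

/-- `lprod k ≤ bprod k` (`D ≥ 1`, `η ≥ 0`). [folklore] -/
theorem lprod_le_bprod (hD : 1 ≤ D) (hη : 0 ≤ η) (k : Multiset ℕ) :
    lprod (D := D) (ε := ε) (η := η) k ≤ bprod (D := D) (ε := ε) (η := η) k := by
  induction k using Multiset.induction_on with
  | empty => rw [bprod_zero, lprod_zero]
  | cons j k ih =>
    rw [bprod_cons, lprod_cons]
    have h0 : (0:ℝ) ≤ D := by linarith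
    exact mul_le_mul (grid_mono hD hη (Nat.le_succ j)) ih (lprod_pos (by linarith) k).le
      (grid_pos (by linarith) _).le

/-- **The hypothesis of Lemma 1 along the recursion**: at every stage (remove the least box repeatedly),
`D₁ ⋯ D_{r−1} D_r² ≤ D`, i.e. `lprod k · D_{mmin k} ≤ D`. [cite: IwaniecActaArith1980b, Lemma 1 (proof) p. 312] -/
def HypL1 : Multiset ℕ → Prop
  | k =>
    if _ : k = 0 then True
    else HypL1 (k.erase (mmin k)) ∧ lprod (D := D) (ε := ε) (η := η) k * grid D ε η (mmin k) ≤ D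
termination_by k => Multiset.card k
decreasing_by
  rw [Multiset.card_erase_of_mem (mmin_mem ‹_›)]
  exact Nat.pred_lt (by rw [Ne, Multiset.card_eq_zero]; exact ‹_›)

/-- Unfolding `HypL1` at `k ≠ 0`. [folklore] -/
theorem hypL1_iff {k : Multiset ℕ} (hk : k ≠ 0) :
    HypL1 (D := D) (ε := ε) (η := η) k ↔
      HypL1 (D := D) (ε := ε) (η := η) (k.erase (mmin k)) ∧
        lprod (D := D) (ε := ε) (η := η) k * grid D ε η (mmin k) ≤ D := by
  rw [HypL1, dif_neg hk]

/-- `HypL1 0`. [folklore] -/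
theorem hypL1_zero : HypL1 (D := D) (ε := ε) (η := η) 0 := by rw [HypL1, dif_pos rfl]; trivial

/-- **Admissible patterns satisfy the hypothesis of Lemma 1** ("But `D₁ ⋯ D_{r−1} D_r² ≤ D`", p. 312):
for `par = 1` unconditionally, for `par = 0` provided every box used lies below `D^{1/2}` (`D_j² ≤ D`,
the condition `D₁ < D^{1/2}` of `ℋ`). [cite: IwaniecActaArith1980b, Lemma 1 (proof) p. 312] -/
theorem hypL1_of_admC (hD : 1 ≤ D) (hη : 0 ≤ η) (par : ℕ) :
    ∀ {k : Multiset ℕ}, AdmC (D := D) (ε := ε) (η := η) par k →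
      (par % 2 = 0 → ∀ j ∈ k, grid D ε η j ^ 2 ≤ D) → HypL1 (D := D) (ε := ε) (η := η) k := by
  intro k
  induction hn : Multiset.card k using Nat.strong_induction_on generalizing k with
  | _ n ih =>
    intro hadm hx
    by_cases hk : k = 0
    · rw [hk]; exact hypL1_zero
    have hjk : mmin k ∈ k := mmin_mem hk
    have hpos : 0 < Multiset.card k := Multiset.card_pos.mpr hk
    have hcard : Multiset.card (k.erase (mmin k)) + 1 = Multiset.card k := by
      rw [Multiset.card_erase_of_mem hjk, Nat.pred_eq_sub_one]; omega
    have hlt' : Multiset.card (k.erase (mmin k)) < n := by omega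
    have hadm' := (admC_iff hk).mp hadm
    have hx' : par % 2 = 0 → ∀ i ∈ k.erase (mmin k), grid D ε η i ^ 2 ≤ D :=
      fun hp i hi => hx hp i (Multiset.mem_of_mem_erase hi)
    have IH : HypL1 (D := D) (ε := ε) (η := η) (k.erase (mmin k)) := ih _ hlt' rfl hadm'.1 hx'
    rw [hypL1_iff hk]
    refine ⟨IH, ?_⟩
    have hD0 : (0 : ℝ) ≤ D := by linarith
    have hlk : lprod (D := D) (ε := ε) (η := η) k =
        grid D ε η (mmin k) * lprod (D := D) (ε := ε) (η := η) (k.erase (mmin k)) := by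
      rw [← lprod_erase_mul hjk]; ring
    by_cases hpar : Multiset.card k % 2 = par % 2
    · -- the condition holds at `k` itself
      have hc : bprod (D := D) (ε := ε) (η := η) k * grid D ε η (mmin k + 1) ^ 2 < D := hadm'.2 hpar
      have h1 : lprod (D := D) (ε := ε) (η := η) k ≤ bprod (D := D) (ε := ε) (η := η) k := lprod_le_bprod hD hη k
      have hg1 : 1 ≤ grid D ε η (mmin k + 1) :=
        Real.one_le_rpow hD (mul_nonneg (sq_nonneg ε) (pow_nonneg (by linarith) _))
      have h2 : grid D ε η (mmin k) ≤ grid D ε η (mmin k + 1) ^ 2 := by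
        calc grid D ε η (mmin k) ≤ grid D ε η (mmin k + 1) := grid_mono hD hη (Nat.le_succ _)
          _ ≤ grid D ε η (mmin k + 1) ^ 2 := by nlinarith
      have := mul_le_mul h1 h2 (grid_pos (by linarith) (mmin k)).le
        (le_trans (lprod_pos (by linarith) k).le h1)
      linarith
    · by_cases hk' : k.erase (mmin k) = 0
      · -- `k = {j}`, and the parity is even: use `D_j² ≤ D`
        have hkj : k = {mmin k} := by rw [← Multiset.cons_erase hjk, hk']; rfl
        have hpar0 : par % 2 = 0 := by
          have hc1 : Multiset.card k = 1 := by rw [hkj, Multiset.card_singleton]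
          omega
        have hsq := hx hpar0 (mmin k) hjk
        set j := mmin k with hjdef
        rw [hkj]
        simp only [lprod, Multiset.map_singleton, Multiset.prod_singleton]
        nlinarith
      · -- the condition holds at `k' = k.erase j`, whose least box `j' ≥ j`
        have hj'k' : mmin (k.erase (mmin k)) ∈ k.erase (mmin k) := mmin_mem hk'
        have hjj' : mmin k ≤ mmin (k.erase (mmin k)) := mmin_le (Multiset.mem_of_mem_erase hj'k')
        have hpar' : Multiset.card (k.erase (mmin k)) % 2 = par % 2 := by omega
        have hc : bprod (D := D) (ε := ε) (η := η) (k.erase (mmin k)) *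
            grid D ε η (mmin (k.erase (mmin k)) + 1) ^ 2 < D := ((admC_iff hk').mp hadm'.1).2 hpar'
        have h1 : lprod (D := D) (ε := ε) (η := η) (k.erase (mmin k)) ≤
            bprod (D := D) (ε := ε) (η := η) (k.erase (mmin k)) := lprod_le_bprod hD hη _
        have h2 : grid D ε η (mmin k) ≤ grid D ε η (mmin (k.erase (mmin k)) + 1) := grid_mono hD hη (by omega)
        have hg0 : 0 ≤ grid D ε η (mmin k) := (grid_pos (by linarith) _).le
        have hl0 : 0 ≤ lprod (D := D) (ε := ε) (η := η) (k.erase (mmin k)) := (lprod_pos (by linarith) _).le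
        calc lprod (D := D) (ε := ε) (η := η) k * grid D ε η (mmin k)
            = lprod (D := D) (ε := ε) (η := η) (k.erase (mmin k)) * (grid D ε η (mmin k) * grid D ε η (mmin k)) := by
              rw [hlk]; ring
          _ ≤ bprod (D := D) (ε := ε) (η := η) (k.erase (mmin k)) *
              (grid D ε η (mmin (k.erase (mmin k)) + 1) * grid D ε η (mmin (k.erase (mmin k)) + 1)) :=
              mul_le_mul h1 (mul_le_mul h2 h2 hg0 (le_trans hg0 h2)) (mul_nonneg hg0 hg0) (le_trans hl0 h1)
          _ = bprod (D := D) (ε := ε) (η := η) (k.erase (mmin k)) *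
              grid D ε η (mmin (k.erase (mmin k)) + 1) ^ 2 := by ring
          _ ≤ D := hc.le

variable (Mb : ℝ)

/-- **The splitting of Lemma 1** (greedy along the recursion): remove the least box `j`, split the rest as
`(a, b)`, and put `j` on the `M`-side if `D_j · lprod a ≤ M'`, else on the `N`-side.
[cite: IwaniecActaArith1980b, Lemma 1 p. 312] -/
def splitK : Multiset ℕ → Multiset ℕ × Multiset ℕ
  | k =>
    if _ : k = 0 then (0, 0)
    else
      let s := splitK (k.erase (mmin k))
      if lprod (D := D) (ε := ε) (η := η) (mmin k ::ₘ s.1) ≤ Mb then (mmin k ::ₘ s.1, s.2)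
      else (s.1, mmin k ::ₘ s.2)
termination_by k => Multiset.card k
decreasing_by
  rw [Multiset.card_erase_of_mem (mmin_mem ‹_›)]
  exact Nat.pred_lt (by rw [Ne, Multiset.card_eq_zero]; exact ‹_›)

variable {Mb}

/-- `splitK 0 = (0, 0)`. [folklore] -/
theorem splitK_zero : splitK (D := D) (ε := ε) (η := η) Mb 0 = (0, 0) := by
  rw [splitK, dif_pos rfl]

/-- Unfolding `splitK` at `k ≠ 0`. [folklore] -/
theorem splitK_of_ne_zero {k : Multiset ℕ} (hk : k ≠ 0) :
    splitK (D := D) (ε := ε) (η := η) Mb k =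
      if lprod (D := D) (ε := ε) (η := η) (mmin k ::ₘ (splitK (D := D) (ε := ε) (η := η) Mb (k.erase (mmin k))).1) ≤ Mb
      then (mmin k ::ₘ (splitK (D := D) (ε := ε) (η := η) Mb (k.erase (mmin k))).1,
        (splitK (D := D) (ε := ε) (η := η) Mb (k.erase (mmin k))).2)
      else ((splitK (D := D) (ε := ε) (η := η) Mb (k.erase (mmin k))).1,
        mmin k ::ₘ (splitK (D := D) (ε := ε) (η := η) Mb (k.erase (mmin k))).2) := by
  rw [splitK, dif_neg hk]

/-- **Lemma 1** (Iwaniec 1980b, p. 312): if `M', N' ≥ 1`, `M' N' = D`, then every pattern satisfying the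
hypothesis `HypL1` (in particular every admissible one, `hypL1_of_admC`) is the disjoint union of the two
parts of `splitK`, with `∏_{j ∈ k_M} D_j ≤ M'` and `∏_{j ∈ k_N} D_j ≤ N'`.
[cite: IwaniecActaArith1980b, Lemma 1 p. 312] -/
theorem splitK_spec (hD : 0 < D) {Nb : ℝ} (hMb : 1 ≤ Mb) (hNb : 1 ≤ Nb) (hMN : Mb * Nb = D) :
    ∀ {k : Multiset ℕ}, HypL1 (D := D) (ε := ε) (η := η) k →
      (splitK (D := D) (ε := ε) (η := η) Mb k).1 + (splitK (D := D) (ε := ε) (η := η) Mb k).2 = k ∧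
        lprod (D := D) (ε := ε) (η := η) (splitK (D := D) (ε := ε) (η := η) Mb k).1 ≤ Mb ∧
          lprod (D := D) (ε := ε) (η := η) (splitK (D := D) (ε := ε) (η := η) Mb k).2 ≤ Nb := by
  intro k
  induction hn : Multiset.card k using Nat.strong_induction_on generalizing k with
  | _ n ih =>
    intro hyp
    by_cases hk : k = 0
    · subst hk; rw [splitK_zero]; exact ⟨by simp, by rw [lprod_zero]; exact hMb, by rw [lprod_zero]; exact hNb⟩
    have hjk : mmin k ∈ k := mmin_mem hk
    have hpos : 0 < Multiset.card k := Multiset.card_pos.mpr hk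
    have hlt' : Multiset.card (k.erase (mmin k)) < n := by
      rw [Multiset.card_erase_of_mem hjk, Nat.pred_eq_sub_one]; omega
    rw [hypL1_iff hk] at hyp
    obtain ⟨IH1, IH2, IH3⟩ := ih _ hlt' rfl hyp.1
    set j := mmin k with hjdef
    set a := (splitK (D := D) (ε := ε) (η := η) Mb (k.erase j)).1 with hadef
    set b := (splitK (D := D) (ε := ε) (η := η) Mb (k.erase j)).2 with hbdef
    have hkeq : j ::ₘ k.erase j = k := Multiset.cons_erase hjk
    have hlk : lprod (D := D) (ε := ε) (η := η) k =
        grid D ε η j * (lprod (D := D) (ε := ε) (η := η) a * lprod (D := D) (ε := ε) (η := η) b) := by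
      rw [← lprod_add, IH1, ← lprod_cons, hkeq]
    rw [splitK_of_ne_zero hk]
    by_cases hle : lprod (D := D) (ε := ε) (η := η) (j ::ₘ a) ≤ Mb
    · rw [if_pos hle]
      refine ⟨?_, hle, IH3⟩
      show j ::ₘ a + b = k
      rw [Multiset.cons_add, IH1, hkeq]
    · rw [if_neg hle]
      refine ⟨?_, IH2, ?_⟩
      · show a + j ::ₘ b = k
        rw [Multiset.add_cons, IH1, hkeq]
      · rw [lprod_cons] at hle ⊢
        by_contra hgt
        rw [not_le] at hle hgt
        have hg0 : 0 < grid D ε η j := grid_pos hD j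
        have ha0 : 0 < lprod (D := D) (ε := ε) (η := η) a := lprod_pos hD a
        have hb0 : 0 < lprod (D := D) (ε := ε) (η := η) b := lprod_pos hD b
        have h1 : Mb * Nb < (grid D ε η j * lprod (D := D) (ε := ε) (η := η) a) *
            (grid D ε η j * lprod (D := D) (ε := ε) (η := η) b) :=
          mul_lt_mul'' hle hgt (by linarith) (by linarith)
        have h2 : (grid D ε η j * lprod (D := D) (ε := ε) (η := η) a) *
            (grid D ε η j * lprod (D := D) (ε := ε) (η := η) b) =
            lprod (D := D) (ε := ε) (η := η) k * grid D ε η j := by rw [hlk]; ring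
        linarith [hyp.2]

end LemmaOne

/-! ### A finite universe of patterns and its size -/

section Universe

/-- The patterns of cardinality `r` with entries `< J`, realised as the image of the words of length `r`
over `Fin J`. [folklore] -/
def patternsOfCard (J r : ℕ) : Finset (Multiset ℕ) :=
  (Finset.univ : Finset (List.Vector (Fin J) r)).image fun v => ((v.toList.map Fin.val : List ℕ) : Multiset ℕ)

/-- `#patternsOfCard J r ≤ J^r`. [folklore] -/
theorem card_patternsOfCard_le (J r : ℕ) : (patternsOfCard J r).card ≤ J ^ r := by
  refine (Finset.card_image_le).trans ?_
  rw [Finset.card_univ, card_vector, Fintype.card_fin]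

/-- A multiset of cardinality `r` with entries `< J` lies in `patternsOfCard J r`. [folklore] -/
theorem mem_patternsOfCard {J : ℕ} {k : Multiset ℕ} (hk : ∀ j ∈ k, j < J) :
    k ∈ patternsOfCard J (Multiset.card k) := by
  induction k using Quotient.inductionOn with
  | h l =>
    rw [patternsOfCard, Finset.mem_image]
    have hl : ∀ j ∈ l, j < J := fun j hj => hk j (Multiset.mem_coe.mpr hj)
    refine ⟨⟨l.pmap (fun j hj => (⟨j, hj⟩ : Fin J)) hl, by simp⟩, Finset.mem_univ _, ?_⟩
    simp only [Multiset.quot_mk_to_coe, Multiset.coe_eq_coe]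
    have : (List.pmap (fun j hj => (⟨j, hj⟩ : Fin J)) l hl).map Fin.val = l := by
      rw [List.map_pmap]; simp
    rw [List.Vector.toList_mk, this]

/-- The universe of patterns: cardinality `≤ R`, entries `< J`. [folklore] -/
def patternsLe (J R : ℕ) : Finset (Multiset ℕ) :=
  (Finset.range (R + 1)).biUnion fun r => patternsOfCard J r

/-- `#patternsLe J R ≤ (R + 1) J^R` for `J ≥ 1`. [folklore] -/
theorem card_patternsLe_le {J : ℕ} (hJ : 1 ≤ J) (R : ℕ) : (patternsLe J R).card ≤ (R + 1) * J ^ R := by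
  refine (Finset.card_biUnion_le).trans ?_
  calc ∑ r ∈ Finset.range (R + 1), (patternsOfCard J r).card
      ≤ ∑ r ∈ Finset.range (R + 1), J ^ R := Finset.sum_le_sum fun r hr =>
        (card_patternsOfCard_le J r).trans (Nat.pow_le_pow_right hJ (Nat.lt_succ_iff.mp (Finset.mem_range.mp hr)))
    _ = (R + 1) * J ^ R := by rw [Finset.sum_const, Finset.card_range, smul_eq_mul]

/-- A multiset of cardinality `≤ R` with entries `< J` lies in `patternsLe J R`. [folklore] -/
theorem mem_patternsLe {J R : ℕ} {k : Multiset ℕ} (hk : ∀ j ∈ k, j < J) (hR : Multiset.card k ≤ R) :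
    k ∈ patternsLe J R := by
  rw [patternsLe, Finset.mem_biUnion]
  exact ⟨Multiset.card k, Finset.mem_range.mpr (Nat.lt_succ_of_le hR), mem_patternsOfCard hk⟩

/-- Sub-multisets stay in the universe. [folklore] -/
theorem mem_patternsLe_of_le {J R : ℕ} {k k' : Multiset ℕ} (hk : k ∈ patternsLe J R) (hle : k' ≤ k) :
    k' ∈ patternsLe J R := by
  rw [patternsLe, Finset.mem_biUnion] at hk
  obtain ⟨r, hr, hkr⟩ := hk
  rw [patternsOfCard, Finset.mem_image] at hkr
  obtain ⟨v, -, rfl⟩ := hkr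
  refine mem_patternsLe (fun j hj => ?_) ?_
  · have hj' := Multiset.mem_of_le hle hj
    rw [Multiset.mem_coe, List.mem_map] at hj'
    obtain ⟨a, -, rfl⟩ := hj'
    exact a.isLt
  · refine (Multiset.card_le_card hle).trans ?_
    rw [Multiset.coe_card, List.length_map, List.Vector.toList_length]
    exact Nat.lt_succ_iff.mp (Finset.mem_range.mp hr)

end Universe

/-! ### Size of the patterns in the support -/

section Support

variable (hD : 1 < D) (hε : 0 < ε) (hη : 0 < η)
include hD hε hη

/-- **Cardinality of a pattern in the support**: if the squarefree `t < D` has all its prime factors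
`≥ u = D₀ = D^{ε²}`, then `ν(t) < ε⁻²`. [cite: IwaniecActaArith1980b, §4 p. 314 (u = D^{ε²})] -/
theorem card_primeFactors_lt {t : ℕ} (ht : Squarefree t) (hu : ∀ p ∈ t.primeFactors, grid D ε η 0 ≤ (p : ℝ))
    (htD : (t : ℝ) < D) : (t.primeFactors.card : ℝ) < ε⁻¹ ^ 2 := by
  have hD0 : (0 : ℝ) < D := by linarith
  have hlogD : 0 < Real.log D := Real.log_pos hD
  have hu1 : (1 : ℝ) ≤ grid D ε η 0 := (one_lt_grid hD hε (by linarith) 0).le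
  -- `u^{ν(t)} ≤ t < D`
  have h1 : grid D ε η 0 ^ t.primeFactors.card ≤ (t : ℝ) := by
    conv_rhs => rw [← Nat.prod_primeFactors_of_squarefree ht]
    push_cast
    rw [← Finset.prod_const]
    exact Finset.prod_le_prod (fun _ _ => by linarith) fun p hp => hu p hp
  have h2 : grid D ε η 0 ^ t.primeFactors.card < D := lt_of_le_of_lt h1 htD
  -- take logarithms: `ν ε² log D < log D`
  have h3 : (t.primeFactors.card : ℝ) * (ε ^ 2 * Real.log D) < Real.log D := by
    have := Real.log_lt_log (pow_pos (by linarith) _) h2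
    rwa [Real.log_pow, grid, pow_zero, mul_one, Real.log_rpow hD0] at this
  have h4 : (t.primeFactors.card : ℝ) * ε ^ 2 < 1 := by
    by_contra h
    rw [not_lt] at h
    have : Real.log D ≤ (t.primeFactors.card : ℝ) * ε ^ 2 * Real.log D := by nlinarith
    linarith
  rw [inv_pow, ← one_div, lt_div_iff₀ (pow_pos hε 2)]
  exact h4

/-- The boxes of the prime factors of `t` are at most the box of any bound `Q` for them. [folklore] -/
theorem forall_mem_pat_lt {t Q : ℕ} (hQ : ∀ p ∈ t.primeFactors, p ≤ Q) :
    ∀ j ∈ pat hD hε hη t, j < boxIdx hD hε hη Q + 1 := by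
  intro j hj
  obtain ⟨p, hp, rfl⟩ := (mem_pat_iff hD hε hη).mp hj
  exact Nat.lt_succ_of_le (boxIdx_mono hD hε hη (hQ p hp))

/-- **The patterns of the support lie in the finite universe** `patternsLe (boxIdx Q + 1) R` as soon as
`ε⁻² ≤ R`: for squarefree `t < D` with prime factors in `[u, Q]`. [folklore] -/
theorem pat_mem_patternsLe {t Q R : ℕ} (ht : Squarefree t) (hu : ∀ p ∈ t.primeFactors, grid D ε η 0 ≤ (p : ℝ))
    (htD : (t : ℝ) < D) (hQ : ∀ p ∈ t.primeFactors, p ≤ Q) (hR : ε⁻¹ ^ 2 ≤ (R : ℝ)) :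
    pat hD hε hη t ∈ patternsLe (boxIdx hD hε hη Q + 1) R := by
  refine mem_patternsLe (forall_mem_pat_lt hD hε hη hQ) ?_
  have h := (card_primeFactors_lt hD hε hη ht hu htD).trans_le hR
  rw [card_pat]
  exact_mod_cast h.le

end Support

end Iwaniec1980b

end Literature.NumberTheory.Sieve

end
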